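import Summits.KontsevichZagierPeriods.KontsevichZagierPeriods.Theorems.GrothendieckSectorComplementStubSaturationKernel
import Summits.KontsevichZagierPeriods.KontsevichZagierPeriods.Theorems.GrothendieckSectorComplementStubPiLineKernel
import Summits.KontsevichZagierPeriods.KontsevichZagierPeriods.Theorems.GrothendieckSectorComplementStubLemRingKernel
import Summits.KontsevichZagierPeriods.KontsevichZagierPeriods.Theorems.GrothendieckSectorComplementStubWordClass
import Summits.KontsevichZagierPeriods.KontsevichZagierPeriods.Theorems.GrothendieckGpcZeta4Eq4zeta31

/-!
# Containment joins are free: the π-root ring through weight 4 and the ring join with `ℤ[K, E, π]`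
# (stub `stub_ringJoin` + glue `piRootRing`; line `containment-join` (ring level); crux
# `Grothendieck.SectorComplement`, stmt-KontsevichZagierPeriods-11102)

Conjecture 1 of Kontsevich–Zagier in kernel form ON A SECTOR is injectivity of the evaluation
`evalP : P →+* ℝ` on a subring of the formal period ring `P = FormalRep ⧸ relations`
(`KZ.FormalPeriodRing`; the whole conjecture is injectivity of `evalP`,
`kzKernelConjecture_iff_injective_evalP`). This file lands the RING-LEVEL splice grammar of the
declared-remainder crux `SectorComplement` and its two instances:

* §1 `aeval_mem_closure` (bookkeeping);
* §2 **`piRootRing` — UNCONDITIONAL**: `evalP` is injective on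
  `ℤ[ϖ, ⟦ζ(2)⟧, ⟦ζ(4)⟧, ⟦ζ(3,1)⟧, ⟦ζ(2,2)⟧, ⟦ζ(2,1,1)⟧]` (`ϖ = ⟦[ℝ, 1/(1+x²)]⟧`, all admissible word
  classes of weights `2`, `4` with any rational scalar): EVERY polynomial identity with integer
  coefficients among `π, ζ(2), ζ(4), ζ(3,1), ζ(2,2), ζ(2,1,1)` is derivable by the three rules —
  the even-weight-`≤ 4` multiple-zeta RING sector of Conjecture 1 (the route header's "NOT DECOMPOSED
  YET (c)"). Inputs: the saturation lemma (`stub_saturationKernel`, p99032), Lindemann read in `P`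
  (`stub_piLineKernel`, p100184: `transcendental_pi_holds`), and ONE transfer per generator
  (`stub_wordClass`: the rungs `weightKernelAdm_two` / `weightKernel_four` and the Euler crosses);
* §3 **`stub_ringJoin`**: `H₁ = LemniscaticSectorKernel` gives injectivity of `evalP` on
  `ℤ[κ, ε, ϖ, ⟦ζ(2)⟧, ⟦ζ(4)⟧, ⟦ζ(3,1)⟧, ⟦ζ(2,2)⟧, ⟦ζ(2,1,1)⟧]` — the lemniscatic ring joined with the
  π-root ring (products `K·ζ(4)`, `E·ζ(2)²`, … included), no transcendence input beyond `H₁`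
  (`stub_lemRingKernel`, p101354);
* §4 corollaries at the level of representations: kernel form / "equal values ⇒ equivalent" for
  formal combinations with class in the π-root ring, and Euler's `2·[Δ₂×Δ₂, ω₀₁⊗ω₀₁] ≡ 5·[Δ₄, ω₀₀₀₁]`
  (`ζ(2)² = 5ζ(4)/2`) as a move-derivable identity;
* (sequel file `GrothendieckSectorComplementRingJoinRoots.lean`: the first CROSS-ROOT junction `ζ(3)`
  PRICED at ring level, and a second UNCONDITIONAL root `ℤ[K(1/√2), π]` by Chudnovsky joined with the
  MZV words — registered stub `stub_ringJoinKPi`);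
* §5 read-back: the line's declared remainder "injectivity on the ring join → Statement" is
  EQUIVALENT to the crux (`ringRemainder_iff_crux`) — the join relocates no strength
  (`Cruxes/SectorComplement/Disproof.lean`, `crux_iff_summit_of`).

References: M. Kontsevich, D. Zagier, *Periods* (2001), §1.2, §4.1; F. Lindemann (1882); L. Euler
(1735).
-/

noncomputable section

open MeasureTheory Set
open Literature.NumberTheory.Transcendental
open Literature.NumberTheory.Transcendental.KZ
open MvPolynomial (aeval X C)
open Summit.KontsevichZagierPeriods.KontsevichZagierPeriods.Theses.Grothendieck
open Summit.KontsevichZagierPeriods.Grothendieck.GpcLegendreLemniscaticNegative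
open Summit.KontsevichZagierPeriods.Grothendieck.LemniscaticSectorGlue
open Summit.KontsevichZagierPeriods.Grothendieck.SectorComplementAmalgamation
open Summit.KontsevichZagierPeriods.MzvKernelInKZ.Negative

namespace Summit.KontsevichZagierPeriods.Grothendieck.SectorComplementRingJoin

/-! ## §1 Bookkeeping -/

/-- Every polynomial expression in generators lies in the subring generated by them and any further
set. [folklore] -/
theorem aeval_mem_closure {k : ℕ} (v : Fin k → FormalPeriodRing) (T : Set FormalPeriodRing)
    (P : MvPolynomial (Fin k) ℤ) :
    aeval v P ∈ Subring.closure (Set.range v ∪ T) := by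
  induction P using MvPolynomial.induction_on with
  | C a =>
    rw [MvPolynomial.algHom_C, algebraMap_int_eq, eq_intCast]
    exact intCast_mem _ a
  | add p q hp hq => rw [map_add]; exact Subring.add_mem _ hp hq
  | mul_X p i hp =>
    rw [map_mul, MvPolynomial.aeval_X]
    exact Subring.mul_mem _ hp (Subring.subset_closure (Or.inl ⟨i, rfl⟩))

/-- The new generators of both joins — the admissible word classes of weights `2`, `4` — have non-zero
integer multiples in any subring containing `ϖ` (`stub_wordClass`). [folklore] -/
theorem exists_nsmul_mem_of_wordClass (p : IntegralRep 1) (hpd : p.domain = Set.univ)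
    (hpi : p.integrand = fun x => 1 / (1 + x 0 ^ 2)) (R₀ : Subring FormalPeriodRing)
    (hϖ : toFormalPeriod (of p) ∈ R₀) :
    ∀ t ∈ toFormalPeriod '' (genSetAdm 2 ∪ genSetAdm 4), ∃ n : ℕ, n ≠ 0 ∧ n • t ∈ R₀ := by
  rintro t ⟨x, hx, rfl⟩
  rcases hx with hx | hx
  · obtain ⟨n, z, hn, h⟩ := stub_wordClass 2 (Or.inl rfl) p hpd hpi x hx
    exact ⟨n, hn, h ▸ R₀.zsmul_mem (R₀.pow_mem hϖ 2) z⟩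
  · obtain ⟨n, z, hn, h⟩ := stub_wordClass 4 (Or.inr rfl) p hpd hpi x hx
    exact ⟨n, hn, h ▸ R₀.zsmul_mem (R₀.pow_mem hϖ 4) z⟩

/-! ## §2 The π-root ring through weight 4 (UNCONDITIONAL) -/

/-- **`piRootRing` — THE π-ROOT RING THROUGH WEIGHT 4, UNCONDITIONAL** (glue theorem of line
`containment-join`, crux stmt-KontsevichZagierPeriods-11102). `evalP` is injective on the subring of
the formal period ring generated by `ϖ = ⟦[ℝ, 1/(1+x²)]⟧` and the classes of all admissible MZV word
representations of weights `2` and `4`: every polynomial identity with integer coefficients among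
`π, ζ(2), ζ(4), ζ(3,1), ζ(2,2), ζ(2,1,1)` is move-derivable. Proof: saturation over `R₀ = ℤ[ϖ]`
(Lindemann) by one transfer per generator. [Kontsevich–Zagier 2001, §1.2, §4.1; Lindemann 1882] -/
theorem piRootRing :
    ∀ (p : IntegralRep 1), p.domain = Set.univ → (p.integrand = fun x => 1 / (1 + x 0 ^ 2)) →
      ∀ x ∈ Subring.closure ({toFormalPeriod (of p)} ∪ toFormalPeriod '' (genSetAdm 2 ∪ genSetAdm 4)),
        evalP x = 0 → x = 0 := by
  intro p hpd hpi
  let R₀ : Subring FormalPeriodRing :=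
    (Polynomial.aeval (R := ℤ) (toFormalPeriod (of p))).range.toSubring
  have hR₀ : ∀ x ∈ R₀, evalP x = 0 → x = 0 := by
    rintro x ⟨f, rfl⟩ hx
    exact stub_piLineKernel p hpd hpi f hx
  have hϖ : toFormalPeriod (of p) ∈ R₀ := ⟨Polynomial.X, by simp⟩
  intro x hx
  refine stub_saturationKernel R₀ _ hR₀ (exists_nsmul_mem_of_wordClass p hpd hpi R₀ hϖ) x
    (Subring.closure_mono ?_ hx)
  rintro y (rfl | hy)
  · exact Or.inl hϖ
  · exact Or.inr hy

/-! ## §3 The ring join given `H₁` -/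

/-- **`stub_ringJoin` — THE RING JOIN** (registered stub of line `containment-join`, crux
stmt-KontsevichZagierPeriods-11102). `H₁ = LemniscaticSectorKernel` gives injectivity of `evalP` on
the subring generated by `κ = ⟦[k]⟧`, `ε = ⟦[e]⟧`, `ϖ = ⟦[p]⟧` and all admissible word classes of
weights `2`, `4`: the lemniscatic sector ring joined with the π-root ring, with NO transcendence input
beyond `H₁`. Proof: saturation over `R₀ = ℤ[κ, ε, ϖ]` (`stub_lemRingKernel`). [Kontsevich–Zagier
2001, §1.2, §4.1] -/
theorem stub_ringJoin :
    LemniscaticSectorKernel →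
    ∀ (p : IntegralRep 1), p.domain = Set.univ → (p.integrand = fun x => 1 / (1 + x 0 ^ 2)) →
      ∀ x ∈ Subring.closure
          ({toFormalPeriod (of kRep), toFormalPeriod (of eRep), toFormalPeriod (of p)} ∪
            toFormalPeriod '' (genSetAdm 2 ∪ genSetAdm 4)),
        evalP x = 0 → x = 0 := by
  intro h1 p hpd hpi
  let v : Fin 3 → FormalPeriodRing :=
    ![toFormalPeriod (of kRep), toFormalPeriod (of eRep), toFormalPeriod (of p)]
  let R₀ : Subring FormalPeriodRing := (aeval (R := ℤ) v).range.toSubring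
  have hR₀ : ∀ x ∈ R₀, evalP x = 0 → x = 0 := by
    rintro x ⟨P, rfl⟩ hx
    exact stub_lemRingKernel h1 p hpd hpi P hx
  have hX : ∀ i : Fin 3, v i ∈ R₀ := fun i => ⟨X i, by simp⟩
  intro x hx
  refine stub_saturationKernel R₀ _ hR₀ (exists_nsmul_mem_of_wordClass p hpd hpi R₀ (hX 2)) x
    (Subring.closure_mono ?_ hx)
  rintro y (hy | hy)
  · left
    simp only [mem_insert_iff, mem_singleton_iff] at hy
    rcases hy with rfl | rfl | rfl
    · exact hX 0
    · exact hX 1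
    · exact hX 2
  · exact Or.inr hy

/-! ## §4 Corollaries at the level of representations -/

/-- **Kernel form on the π-root ring, for formal combinations**: a formal `ℤ`-combination of
representations whose class lies in the π-root ring through weight `4` and whose value vanishes is a
relation — unconditionally. [Kontsevich–Zagier 2001, §1.2] -/
theorem mem_relations_of_toFormalPeriod_mem_piRootRing (p : IntegralRep 1)
    (hpd : p.domain = Set.univ) (hpi : p.integrand = fun x => 1 / (1 + x 0 ^ 2)) {c : FormalRep}
    (hc : toFormalPeriod c ∈
      Subring.closure ({toFormalPeriod (of p)} ∪ toFormalPeriod '' (genSetAdm 2 ∪ genSetAdm 4)))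
    (h0 : eval c = 0) : c ∈ relations := by
  rw [← toFormalPeriod_eq_zero_iff]
  exact piRootRing p hpd hpi _ hc (by rwa [evalP_toFormalPeriod])

/-- **Conjecture 1 on the π-root ring, two-representation form**: two representations (of any
dimensions) whose classes lie in the π-root ring through weight `4` and which have the same value are
KZ-equivalent — unconditionally. [Kontsevich–Zagier 2001, §1.2, Conjecture 1] -/
theorem equivalent_of_mem_piRootRing (p : IntegralRep 1) (hpd : p.domain = Set.univ)
    (hpi : p.integrand = fun x => 1 / (1 + x 0 ^ 2)) {n m : ℕ} (r : IntegralRep n)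
    (r' : IntegralRep m)
    (hr : toFormalPeriod (of r) ∈
      Subring.closure ({toFormalPeriod (of p)} ∪ toFormalPeriod '' (genSetAdm 2 ∪ genSetAdm 4)))
    (hr' : toFormalPeriod (of r') ∈
      Subring.closure ({toFormalPeriod (of p)} ∪ toFormalPeriod '' (genSetAdm 2 ∪ genSetAdm 4)))
    (hv : r.value = r'.value) : Equivalent r r' :=
  mem_relations_of_toFormalPeriod_mem_piRootRing p hpd hpi
    (by rw [map_sub]; exact Subring.sub_mem _ hr hr')
    (by rw [map_sub, eval_of, eval_of, hv, sub_self])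

/-- **Euler's `ζ(2)² = (5/2)·ζ(4)` inside the calculus**: `2·[Δ₂ × Δ₂, ω₀₁ ⊗ ω₀₁] − 5·[Δ₄, ω₀₀₀₁]` is
a relation (the Fubini square `P22` of the `ζ(2)` word representation against the `ζ(4)` word
representation) — a PRODUCT identity, obtained here with no stuffle and no new chain: both classes lie
in the π-root ring and the values agree. [Euler 1735; Kontsevich–Zagier 2001, §1.2] -/
theorem two_P22_sub_five_zeta4_mem_relations :
    2 • of P22 - 5 • of (wordRep ω4 1 adm_ω4) ∈ relations := by
  obtain ⟨p, hpd, hpi⟩ := exists_piRep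
  set S := Subring.closure
    ({toFormalPeriod (of p)} ∪ toFormalPeriod '' (genSetAdm 2 ∪ genSetAdm 4)) with hS
  have h2 : toFormalPeriod (of (wordRep ω2 1 adm_ω2)) ∈ S :=
    Subring.subset_closure (Or.inr ⟨_, Or.inl (of_wordRep_mem_genSetAdm _ _ _), rfl⟩)
  have h4 : toFormalPeriod (of (wordRep ω4 1 adm_ω4)) ∈ S :=
    Subring.subset_closure (Or.inr ⟨_, Or.inr (of_wordRep_mem_genSetAdm _ _ _), rfl⟩)
  have hP22 : toFormalPeriod (of P22) =
      toFormalPeriod (of (wordRep ω2 1 adm_ω2)) * toFormalPeriod (of (wordRep ω2 1 adm_ω2)) := by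
    rw [toFormalPeriod_of_mul_of]; rfl
  refine mem_relations_of_toFormalPeriod_mem_piRootRing p hpd hpi ?_ ?_
  · rw [map_sub, map_nsmul, map_nsmul, hP22]
    exact Subring.sub_mem _ (nsmul_mem (Subring.mul_mem _ h2 h2) _)
      (nsmul_mem h4 _)
  · have hv22 : eval (of P22) = (Real.pi ^ 2 / 6) * (Real.pi ^ 2 / 6) := by
      rw [← evalP_toFormalPeriod, hP22, map_mul, evalP_toFormalPeriod_of, value_ω2]
    rw [map_sub, map_nsmul, map_nsmul, hv22, eval_of, value_ω4]
    ring

/-! ## §5 Read-back for the planner: the remainder of the line is EXACTLY the crux -/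

/-- Converse adapter: injectivity of `evalP` on `ℤ[κ, ε, ϖ]` (for one representation `p` of `π`)
gives back `H₁` — the class of a `Fintype`-indexed combination of lemniscatic monomial
representations is `ψ(P_z)`, `P_z = Σ zᵢ xᵃⁱ yᵇⁱ zᶜⁱ` (as in `lemniscaticSectorGlue_proof`). [folklore] -/
theorem lsk_of_lemRingKernel (p : IntegralRep 1) (hpd : p.domain = Set.univ)
    (hpi : p.integrand = fun x => 1 / (1 + x 0 ^ 2))
    (h : ∀ P : MvPolynomial (Fin 3) ℤ,
      evalP (aeval ![toFormalPeriod (of kRep), toFormalPeriod (of eRep), toFormalPeriod (of p)] P) = 0 →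
      aeval ![toFormalPeriod (of kRep), toFormalPeriod (of eRep), toFormalPeriod (of p)] P = 0) :
    LemniscaticSectorKernel := by
  intro ι _ z a b c r hdom hint heval
  choose m hmd hmi hmP using fun i => exists_monoRep p hpd hpi (a i) (b i) (c i)
  have hEq : ∀ i, Equivalent (r i) (m i) := fun i =>
    equivalent_of_eqOn (r i) _ (by rw [hmd, hdom i]) (by rw [hmi]; exact hint i)
  have hS : toFormalPeriod (∑ i, z i • of (r i)) =
      aeval ![toFormalPeriod (of kRep), toFormalPeriod (of eRep), toFormalPeriod (of p)]
        (∑ i, z i • (X 0 ^ a i * X 1 ^ b i * X 2 ^ c i : MvPolynomial (Fin 3) ℤ)) := by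
    rw [map_sum, map_sum]
    refine Finset.sum_congr rfl fun i _ => ?_
    rw [map_zsmul, map_zsmul, (hEq i).toFormalPeriod_eq, hmP]
    simp only [map_mul, map_pow, MvPolynomial.aeval_X]
    rfl
  rw [← toFormalPeriod_eq_zero_iff, hS]
  refine h _ ?_
  rw [← hS, evalP_toFormalPeriod]
  exact heval

/-- The ring-join kernel (for one representation `p` of `π`) gives back `H₁`. [folklore] -/
theorem lsk_of_ringJoinKernel (p : IntegralRep 1) (hpd : p.domain = Set.univ)
    (hpi : p.integrand = fun x => 1 / (1 + x 0 ^ 2))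
    (h : ∀ x ∈ Subring.closure
        ({toFormalPeriod (of kRep), toFormalPeriod (of eRep), toFormalPeriod (of p)} ∪
          toFormalPeriod '' (genSetAdm 2 ∪ genSetAdm 4)),
      evalP x = 0 → x = 0) :
    LemniscaticSectorKernel := by
  refine lsk_of_lemRingKernel p hpd hpi fun P hP => h _ ?_ hP
  have hmem := aeval_mem_closure
    ![toFormalPeriod (of kRep), toFormalPeriod (of eRep), toFormalPeriod (of p)]
    (toFormalPeriod '' (genSetAdm 2 ∪ genSetAdm 4)) P
  refine Subring.closure_mono (Set.union_subset_union_left _ ?_) hmem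
  rintro y ⟨i, rfl⟩
  fin_cases i <;> simp

/-- **`H₁` ↔ the ring-join kernel** (the join converts `H₁` into more kernel statements and back).
[folklore] -/
theorem lsk_iff_ringJoinKernel :
    LemniscaticSectorKernel ↔
      ∀ (p : IntegralRep 1), p.domain = Set.univ → (p.integrand = fun x => 1 / (1 + x 0 ^ 2)) →
        ∀ x ∈ Subring.closure
            ({toFormalPeriod (of kRep), toFormalPeriod (of eRep), toFormalPeriod (of p)} ∪
              toFormalPeriod '' (genSetAdm 2 ∪ genSetAdm 4)),
          evalP x = 0 → x = 0 := by
  refine ⟨stub_ringJoin, fun h => ?_⟩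
  obtain ⟨p, hpd, hpi⟩ := exists_piRep
  exact lsk_of_ringJoinKernel p hpd hpi (h p hpd hpi)

/-- **THE LINE'S REMAINDER IS EQUIVALENT TO THE CRUX** (nothing lost, nothing gained): "injectivity
of `evalP` on the ring join → Statement" `↔ SectorComplement` — forward by the ring join, backward by
the converse adapter and the theorem `H₂ = GpcZeta4Eq4zeta31` (`gpcZeta4Eq4zeta31_proof`). So the
remainder is summit-strength exactly as the crux is (`Cruxes/SectorComplement/Disproof.lean`,
`crux_iff_summit_of`): modulo `H₁` both are `KontsevichZagierPeriods`. [folklore] -/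
theorem ringRemainder_iff_crux :
    ((∀ (p : IntegralRep 1), p.domain = Set.univ → (p.integrand = fun x => 1 / (1 + x 0 ^ 2)) →
      ∀ x ∈ Subring.closure
          ({toFormalPeriod (of kRep), toFormalPeriod (of eRep), toFormalPeriod (of p)} ∪
            toFormalPeriod '' (genSetAdm 2 ∪ genSetAdm 4)),
        evalP x = 0 → x = 0) → KontsevichZagierPeriods) ↔ SectorComplement :=
  ⟨fun hrem h1 _ => hrem (stub_ringJoin h1),
    fun hcrux hRJ => hcrux (lsk_iff_ringJoinKernel.mpr hRJ) gpcZeta4Eq4zeta31_proof⟩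

/-- In particular, given `H₁`, the remainder IS the Statement. [folklore] -/
theorem ringRemainder_iff_summit_of (h1 : LemniscaticSectorKernel) :
    ((∀ (p : IntegralRep 1), p.domain = Set.univ → (p.integrand = fun x => 1 / (1 + x 0 ^ 2)) →
      ∀ x ∈ Subring.closure
          ({toFormalPeriod (of kRep), toFormalPeriod (of eRep), toFormalPeriod (of p)} ∪
            toFormalPeriod '' (genSetAdm 2 ∪ genSetAdm 4)),
        evalP x = 0 → x = 0) → KontsevichZagierPeriods) ↔ KontsevichZagierPeriods :=
  ⟨fun hrem => hrem (stub_ringJoin h1), fun hs _ => hs⟩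

end Summit.KontsevichZagierPeriods.Grothendieck.SectorComplementRingJoin

end
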